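import Summits.HodgeConjecture.HodgeConjecture.Theorems.PadicSemiregularLiftHodgeAbelianVarietiesCMPivotBridge
import HarnessLib

/-!
# Crux `HodgeAbelianVarieties` (stmt-HodgeConjecture-1333), line `cm-pivot` gen 4 — stub 5: the faithful rational representation on `H¹`, packaged

Route `PadicSemiregularLift`, crux r4; line `cm-pivot`. The converse CM-typing bridge
(`∃ S ⊆ End⁰(A)` commutative reduced of rank `2 dim A` ⟹ `IsCM[A]`) consumes the classical faithful
RATIONAL REPRESENTATION of `End⁰(A)` on `H¹(A(ℂ); ℚ)` in the following packaged form
(registered stub `stub_rationalRepresentation`):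

* `stub_rationalRepresentation` — **for a complex abelian variety `A` there are a `ℂ`-basis `b` of
  `H¹(A(ℂ); ℂ)` indexed by `Fin (2 · dim A)` and an injective `ℚ`-algebra homomorphism
  `σ : End⁰(A) = ℚ ⊗_ℤ End A → M_{2 dim A}(ℚ)` such that for every endomorphism `f` the
  complexification of `σ (1 ⊗ f)` is the TRANSPOSE of the matrix of `f^*` on `H¹` in `b`.**

This is steps (1)–(5) of c6's `CMPivot.exists_cmSubalgebra_of_eigenvalues`
(`…CMPivotBridge`), re-indexed by `Fin (2 dim A)` and exposed as data: (1) `H¹(A(ℂ); ℂ)` has a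
`ℂ`-basis of RATIONAL classes (`span_isRationalClass_eq_top_of_isSmoothProjective_holds`) of
cardinality `2 dim A` (`AbelianVariety.finrank_complexBetti_one`) — `exists_finBasis_isRationalClass`;
(2) every pull-back `f^*` has a rational matrix in it (`repr_mem_range_ratCast_of_isRationalClass`);
(3)–(4) `f ↦ (matrix of f^*)ᵀ` is a ring homomorphism `ρ : End A → M_{2g}(ℚ)` (functoriality of
`complexBetti`, additivity `complexBetti_map_add_one`; the transpose because `f * g = g ≫ f` in `End A`
and `complexBetti` is contravariant), INJECTIVE by faithfulness
(`AbelianVariety.hom_eq_of_complexBetti_map_one_eq`); (5) `ρ` extends to an injective `ℚ`-algebra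
homomorphism on `End⁰(A)` (`CMPivot.exists_algHom_endAlgebra_extend`).
References: [MumfordAV1970] §19 Thm. 3 (`End⁰(X)` acts faithfully on `H¹(X, ℚ)`);
[LangeBirkenhake1992] §1.1 Prop. 1.1.6 (injectivity of the rational representation).
-/

set_option linter.dupNamespace false

noncomputable section

open CategoryTheory Polynomial
open scoped Matrix TensorProduct
open Literature.AlgebraicGeometry Literature.AlgebraicGeometry.Motives
  Literature.AlgebraicGeometry.HodgeTheory Literature.AlgebraicTopology.SingularHomology

namespace Summit.HodgeConjecture.HodgeConjecture.Theorems.HodgeAbelianVarieties.CMPivot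

/-! ### A rational basis of `H¹(A(ℂ); ℂ)` indexed by `Fin (2 dim A)` -/

section RationalBasis

/-- **`H¹(A(ℂ); ℂ)` has a `ℂ`-basis of rational classes indexed by `Fin (2 · dim A)`**: rational
classes span (`span_isRationalClass_eq_top_of_isSmoothProjective_holds`), so a maximal independent
family of them is a basis, of cardinality `finrank ℂ H¹ = 2 dim A`
(`AbelianVariety.finrank_complexBetti_one`); re-index it by `Fin (2 dim A)`. [folklore] -/
theorem exists_finBasis_isRationalClass (A : AbelianVariety ℂ) :
    ∃ b : Module.Basis (Fin (2 * A.dim)) ℂ (complexBetti A.X 1), ∀ i, IsRationalClass (b i) := by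
  classical
  haveI := finite_complexBetti_abelianVariety A 1
  obtain ⟨t, hts, htspan, hli⟩ :=
    exists_linearIndependent ℂ {c : complexBetti A.X 1 | IsRationalClass c}
  have hspan : Submodule.span ℂ {c : complexBetti A.X 1 | IsRationalClass c} = ⊤ :=
    span_isRationalClass_eq_top_of_isSmoothProjective_holds _ _
      (AbelianVariety.isSmoothProjective_holds (A := A)) 1
  haveI : Fintype t := (hli.set_finite_of_isNoetherian).fintype
  let b : Module.Basis t ℂ (complexBetti A.X 1) :=
    Module.Basis.mk hli (by rw [Subtype.range_coe, htspan, hspan])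
  have hb : ∀ i, IsRationalClass (b i) := fun i => by
    rw [Module.Basis.mk_apply]
    exact hts i.2
  have hcard : Fintype.card t = 2 * A.dim := by
    rw [← Module.finrank_eq_card_basis b]
    exact AbelianVariety.finrank_complexBetti_one A
  refine ⟨b.reindex (Fintype.equivFinOfCardEq hcard), fun i => ?_⟩
  rw [Module.Basis.reindex_apply]
  exact hb _

end RationalBasis

/-! ### The packaged rational representation (registered stub `stub_rationalRepresentation`) -/

section RationalRepresentation

/-- **The faithful rational representation on `H¹`, packaged**: for a complex abelian variety `A`
there are a `ℂ`-basis `b` of `H¹(A(ℂ); ℂ)` indexed by `Fin (2 · dim A)` and an injective `ℚ`-algebra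
homomorphism `σ : End⁰(A) = ℚ ⊗_ℤ End A → M_{2 dim A}(ℚ)` such that for every endomorphism `f` the
complexification of `σ (1 ⊗ f)` is the transpose of the matrix of `f^*` on `H¹` in the basis `b`.
Proof: in a basis of rational classes (`exists_finBasis_isRationalClass`) every `f^*` has a rational
matrix (`repr_mem_range_ratCast_of_isRationalClass`); `f ↦ (matrix of f^*)ᵀ` is a ring homomorphism
`End A → M_{2g}(ℚ)` (functoriality, `complexBetti_map_add_one`), injective by
`AbelianVariety.hom_eq_of_complexBetti_map_one_eq`, and extends injectively to `End⁰(A)` by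
`exists_algHom_endAlgebra_extend`.
[cite: MumfordAV1970, §19 Thm. 3] [cite: LangeBirkenhake1992, §1.1 Prop. 1.1.6] -/
theorem stub_rationalRepresentation (A : AbelianVariety ℂ) :
    ∃ (b : Module.Basis (Fin (2 * A.dim)) ℂ (HodgeTheory.complexBetti A.X 1))
      (σ : A.endAlgebra →ₐ[ℚ] Matrix (Fin (2 * A.dim)) (Fin (2 * A.dim)) ℚ),
      Function.Injective σ ∧
      ∀ f : A ⟶ A, (σ (AbelianVariety.endAlgebra.of A f)).map (algebraMap ℚ ℂ) =
        (LinearMap.toMatrix b b (HodgeTheory.complexBetti.map f.hom.hom.hom 1).hom)ᵀ := by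
  -- (1) a rational basis of `H¹(A(ℂ); ℂ)` indexed by `Fin (2 dim A)`
  obtain ⟨b, hb⟩ := exists_finBasis_isRationalClass A
  -- (2) the matrix of `f^*` in `b` is rational: `Φ (M f) = matrix of f^*`
  let Φ : Matrix (Fin (2 * A.dim)) (Fin (2 * A.dim)) ℚ →+*
      Matrix (Fin (2 * A.dim)) (Fin (2 * A.dim)) ℂ := (algebraMap ℚ ℂ).mapMatrix
  have hΦ_apply : ∀ X, Φ X = X.map (algebraMap ℚ ℂ) := fun X => RingHom.mapMatrix_apply _ _
  have hΦinj : Function.Injective Φ := fun X Y h =>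
    Matrix.map_injective (algebraMap ℚ ℂ).injective
      (show X.map (algebraMap ℚ ℂ) = Y.map (algebraMap ℚ ℂ) by rw [← hΦ_apply, ← hΦ_apply]; exact h)
  have hrat : ∀ (f : A ⟶ A) (i j : Fin (2 * A.dim)), ∃ q : ℚ, algebraMap ℚ ℂ q =
      LinearMap.toMatrix b b (complexBetti.map f.hom.hom.hom 1).hom i j := fun f i j => by
    obtain ⟨q, hq⟩ := repr_mem_range_ratCast_of_isRationalClass b hb ((hb j).pullback _) i
    exact ⟨q, by rw [LinearMap.toMatrix_apply, eq_ratCast]; exact hq⟩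
  choose M hM using hrat
  have hMmap : ∀ f : A ⟶ A, Φ (Matrix.of (M f)) =
      LinearMap.toMatrix b b (complexBetti.map f.hom.hom.hom 1).hom := fun f => by
    ext i j
    rw [hΦ_apply, Matrix.map_apply, Matrix.of_apply]
    exact hM f i j
  -- (3) functoriality of `f ↦ matrix of f^*`
  have hT_id : LinearMap.toMatrix b b (complexBetti.map (𝟙 A : A ⟶ A).hom.hom.hom 1).hom = 1 := by
    change LinearMap.toMatrix b b (complexBetti.map (𝟙 A.X) 1).hom = 1
    rw [complexBetti.map_id, ModuleCat.hom_id]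
    exact LinearMap.toMatrix_id b
  have hT_comp : ∀ f g : A ⟶ A,
      LinearMap.toMatrix b b (complexBetti.map (f ≫ g).hom.hom.hom 1).hom =
        LinearMap.toMatrix b b (complexBetti.map f.hom.hom.hom 1).hom *
          LinearMap.toMatrix b b (complexBetti.map g.hom.hom.hom 1).hom := fun f g => by
    rw [← LinearMap.toMatrix_mul]
    change LinearMap.toMatrix b b (complexBetti.map (f.hom.hom.hom ≫ g.hom.hom.hom) 1).hom = _
    rw [complexBetti.map_comp, ModuleCat.hom_comp]
    rfl
  have hT_add : ∀ f g : A ⟶ A,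
      LinearMap.toMatrix b b (complexBetti.map (f + g).hom.hom.hom 1).hom =
        LinearMap.toMatrix b b (complexBetti.map f.hom.hom.hom 1).hom +
          LinearMap.toMatrix b b (complexBetti.map g.hom.hom.hom 1).hom := fun f g => by
    rw [complexBetti_map_add_one, ModuleCat.hom_add, map_add]
  have hM_one : Matrix.of (M (𝟙 A)) = 1 := hΦinj (by rw [hMmap, hT_id, map_one])
  have hM_comp : ∀ f g : A ⟶ A, Matrix.of (M (f ≫ g)) = Matrix.of (M f) * Matrix.of (M g) :=
    fun f g => hΦinj (by rw [map_mul, hMmap, hMmap, hMmap, hT_comp])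
  have hM_add : ∀ f g : A ⟶ A, Matrix.of (M (f + g)) = Matrix.of (M f) + Matrix.of (M g) :=
    fun f g => hΦinj (by rw [map_add, hMmap, hMmap, hMmap, hT_add])
  -- (4) the injective ring homomorphism `ρ : End A → M_{2g}(ℚ)`, `f ↦ (M f)ᵀ`
  let ρ₀ : End A →* Matrix (Fin (2 * A.dim)) (Fin (2 * A.dim)) ℚ :=
    { toFun := fun f => (Matrix.of (M f))ᵀ
      map_one' := by
        change (Matrix.of (M (𝟙 A)))ᵀ = 1
        rw [hM_one, Matrix.transpose_one]
      map_mul' := fun f g => by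
        change (Matrix.of (M (g ≫ f)))ᵀ = (Matrix.of (M f))ᵀ * (Matrix.of (M g))ᵀ
        rw [hM_comp, Matrix.transpose_mul] }
  let ρ : End A →+* Matrix (Fin (2 * A.dim)) (Fin (2 * A.dim)) ℚ := RingHom.mk' ρ₀ fun f g => by
    change (Matrix.of (M (f + g)))ᵀ = (Matrix.of (M f))ᵀ + (Matrix.of (M g))ᵀ
    rw [← Matrix.transpose_add]
    exact congrArg Matrix.transpose (hM_add f g)
  have hρ_apply : ∀ f : A ⟶ A, ρ f = (Matrix.of (M f))ᵀ := fun f => rfl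
  have hρinj : Function.Injective ρ := by
    intro f g hfg
    rw [hρ_apply, hρ_apply] at hfg
    have h1 : Matrix.of (M f) = Matrix.of (M g) := Matrix.transpose_injective hfg
    have h2 := congrArg Φ h1
    rw [hMmap, hMmap] at h2
    exact AbelianVariety.hom_eq_of_complexBetti_map_one_eq
      (ModuleCat.hom_ext ((LinearMap.toMatrix b b).injective h2))
  -- (5) extension to `End⁰(A) = ℚ ⊗_ℤ End A`
  obtain ⟨σ, hσinj, hσof⟩ := exists_algHom_endAlgebra_extend A ρ hρinj
  refine ⟨b, σ, hσinj, fun f => ?_⟩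
  rw [hσof f, hρ_apply, Matrix.transpose_map, ← hΦ_apply, hMmap]

end RationalRepresentation

end Summit.HodgeConjecture.HodgeConjecture.Theorems.HodgeAbelianVarieties.CMPivot

end
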